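import Summits.QuantumFields.YangMills.Theorems.BalabanUVNodesN09HregOfPerBondChartsAtRecord
import Literature.MathematicalPhysics.QuantumFieldTheory.Balaban1983to89.BlockAveragingEMLHaarAC
import Literature.MathematicalPhysics.QuantumFieldTheory.Balaban1983to89.LatticeWordStokes

/-!
# NODE N09 [B12] — THE SUPPORT CLAUSE OF THE PRIVATE-COORDINATE ROAD TO `hreg` IS A THEOREM ON THE COARSE SMALL-FIELD DOMAIN:
# where the β-input of record does not vanish and the average is a small field, every private coordinate of the fine configuration sits in its
# central `α`-window (`α = (((d+2)L)²∕4)·ε₀`); plus the fibred-chart door for the maximal regular set with its support clause LOCALISED to that domain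

Cell `pub-ymgap` (YM-PLAN Track A), width seat `pub-ymgap-dag-n09-w5` g4 (D-0154 ∕ R399 (3a) width seat 5 of node N09); helper of K1⁸
`StabilityBRunRowsAtRecordR13SepCoPH` = stmt-QuantumFields-26907 (`--supports`, `--as helper`, count-neutral; K1⁷ stmt-QuantumFields-20542 is the `aside`
predecessor).  [I] = [Balaban1987RG1] (CMP 109), [B7] = [Balaban1985Averaging] (CMP 98), [B11] = [Balaban1985Variational] (CMP 102).

WHY.  N09's Theorem-3 doors at the Stage-13 record display the analytic inclusion `hreg : ∀ j < K, domAlt_{j+1} ⊆ regSetOfRecord K j ρ_j` ([I] p. 259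
«effective actions for small fields»), `ρ_j` the β-input of record `betaInputOfRecord (TβOfRecord₁₃) (chiβOfRecord₁₃ θ) K g j` ((0.19) p. 255 with the (2.9)
fluctuation cutoff in the χ slot).  dag-n09-w6's private-coordinate road (`T4TriangularFibredChart`, `Node00.RegSetOfFibredChartOnSupport`, and the announced
`…N09HregOfPerBondChartsAtRecord.hreg_of_perBondCharts` ∕ `…N09CentralWindowAtRecord`) re-shapes `hreg` into per-bond inversions of the one-variable (0.4)
averages `g ↦ Ū′(c)` on the CENTRAL `α`-WINDOWS `Ωα c U := {g | ∀ i, dist1 (fibreFamily U c (pre U c · g · post U c) i) ≤ α}` and displays, besides the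
forward Jacobian laws and the continuity of the fibre integrals, ONE SUPPORT CLAUSE: *wherever `ρ_j(U) ≠ 0`, every private coordinate `U(β c)` lies in its window
`Ωα c U`* — equivalently (pub-balaban's `BlockAveragingEMLHaarAC.loopHol_update_centralBond_self`) *every (0.4) loop variable of `U` at `c` is within `α` of `1`*.
THIS FILE PROVES IT ON THE COARSE SMALL-FIELD DOMAIN — for fine configurations `U` whose average `Ū` lies in `domAlt_{j+1}` — which is the only place the road's
change-of-variables identity `hmap` ever meets the clause (its restricted measure lives on `Ū⁻¹(domAlt_{j+1}) ∩ S`): `ρ_j(U) ≠ 0` forces `χ^{(2.9)}_j(U) ≠ 0`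
(dag-n09-w6 g2 `…N09HregOfFibredChartAtRecord.mem_setOf_chi_ne_zero_of_betaInputOfRecord_ne_zero`), hence — by the CONTRAPOSITIVE of dag-n09-w4 g3's rider theorem
`…N09B0RiderAtRecord.hχdom_of_hsolν_of_numerics` ([I] p. 266–267 rider + [B7] Prop 2 at the record + the threshold ordering, all supplied there from [B11]-existence
`hsolν` ON THE DOMAIN and numerics) — `U ∈ domAlt_j`, i.e. `|U(∂p) − 1| < ε₀` at every plaquette (K0e, `Node00.SmallFieldChiOfRecord.mem_domAltOfRecord_iff`,
`Iff.rfl`); the tree's crude non-abelian Stokes bound for the closed (0.4) words (`LatticeWordStokes.dist1_loopHol_le`: `dist1 (loopHol U c i) ≤ (((d+2)L)²∕4)·ε₀`)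
then puts every loop variable, hence every private coordinate, in the central `α`-window as soon as `(((d+2)L)²∕4)·ε₀ ≤ α`.  OFF the coarse domain nothing is
derivable: `hsolν` speaks on `domAlt_{j+1}` only, the printed `χ^{(2.9)}` leaves every distinguished variable `B′(b₀(c))` free ((2.9) p. 266), and the on-axis (0.4)
loops at `c` traverse `b₀(c)` (dag-n09-w4 g3 `B12B0LoopGeometry267`); so the clause is supplied LOCALISED, and §3 records that the localisation costs the road
nothing — dag-n09-w6 g3's door `Node00.RegSetOfFibredChartOnSupport.domAlt_subset_regSetOfRecord_of_fibredChart_of_ne_zero` holds verbatim with its support binder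
`hS : ∀ x, ρ x ≠ 0 → x ∈ S` weakened to `∀ x, Ū(x) ∈ domAlt_{k+1} → ρ x ≠ 0 → x ∈ S` (apply the door at `S ∪ (Ū⁻¹ domAlt_{k+1})ᶜ`; same `hmap`, same
`havgΦJ`, same `hgc`).

WHAT IS PROVED (theorems only; 0 def, 0 instance, 0 notation, 0 sorry).
* §1 (any gauge group, level `j + 1 ≤ m + K`) ★ `self_mem_centralWindow_of_loopHol_le` — if every loop variable of `U` at `c` is `α`-small then `U(β c) ∈ Ωα c U`;
  ★ `self_mem_centralWindow_of_plaqSmall` — `PlaqSmall δ U`, `0 ≤ δ`, `(((d+2)L)²∕4)·δ ≤ α` ⇒ the same at EVERY coarse bond.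
* §2 (the Stage-13 record) ★★ `mem_domAltOfRecord_of_betaInput_ne_zero_of_hsolν_of_numerics` — for `j < K`: `Ū ∈ domAlt_{j+1}` ∧ `ρ_j(U) ≠ 0` ⇒ `U ∈ domAlt_j`
  (from `hsolν` + dag-n09-w4 g3's seven numerics + `hord`); ★★★ `supportClauseOn_of_hsolν_of_numerics` — … ⇒ `∀ c, U(β c) ∈ Ωα c U` for
  `(((d+2)L)²∕4)·θ.ν.ε₀ ≤ α`: THE SUPPORT CLAUSE ON THE COARSE DOMAIN; `supportClauseOn_runParams_of_hsolν_of_numerics` — the same at a run `P`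
  (`K := P.K`, `g := gOfRecord₁₃ θ P`), the binder shape of the road; ★ `supportClause_of_hdom` — the GLOBAL-shape clause (any transport `T`, any χ family) from a
  displayed global support hypothesis `hdom : ρ_j(U) ≠ 0 → U ∈ domAlt_j`.
* §3 (generic fibre data `Z τ Φ J S`, any integrable `ρ`) ★★ `subset_regSetOfRecord_of_fibredChart_of_ne_zero_on`, `TcanOfRecord_eqOn_fibreIntegral_of_fibredChart_of_ne_zero_on`,
  ★★ `domAlt_subset_regSetOfRecord_of_fibredChart_of_ne_zero_on` — dag-n09-w6 g3's support-form doors with `hS` LOCALISED to `Ū(x) ∈ U` (resp. `∈ domAlt_{k+1}`).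
* §4 (dag-n09-w6 g3's private-coordinate door, p620434) ★★★ `hreg_of_perBondCharts_on` — `…N09HregOfPerBondChartsAtRecord.hreg_of_perBondCharts` VERBATIM with its
  support binder `hS` LOCALISED to the coarse domain (its §2 `hmap` ∕ `havgΦ` ∕ measurability lemmas BY NAME + §3); ★★★ `hreg_of_perBondCharts_centralWindow_of_hsolν_of_numerics` —
  at the central `α`-windows `Ω j c U := {g | ∀ i, dist1 (fibreFamily U c (pre U c · g · post U c) i) ≤ α}` the support clause is GONE: `hreg` (all `j < P.K`) from per-bond
  inversion data `(T ϑ jd; hTm hθm hjm hright hlaw)` at those windows, their joint measurability `hΩm` and blindness `hΩbl` (dag-n09-w6's announced `…N09CentralWindowAtRecord`),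
  (I19) `hint`, the continuity `hgc`, [B11]-existence `hsolν`, numerics and `(((d+2)L)²∕4)·θ.ν.ε₀ ≤ α`.

HONEST FRAMING.  LOCATED, count-neutral kernel bookkeeping BY NAME: a contrapositive of dag-n09-w4 g3's rider theorem composed with dag-n09-w6 g2's support lemma, K0e's
`Iff.rfl`, the tree's crude Stokes bound and one set identity.  NO Jacobian law, NO continuity `hgc`, NO chart is constructed; [B11] Thm 1 existence on the domains
(`hsolν`) and the numerics («ε₀, ε₁ sufficiently small, L large», [I] Thm 3 p. 264) stay DISPLAYED hypotheses, asserted of NO record; `hreg` is NOT discharged; NOTHING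
of Bałaban's is proved or denied; N09 NOT discharged; conjunct 1 (Lemma 4) and FLAG №7 untouched; K0⁷ ∕ K1⁸ ∕ K3⁷ NOT closed; counts unmoved (typed 28∕28 · discharged
5∕28); no summit statement is proved by this seat; one finite four-torus programme at fixed `ε = L^{−K}` per run — R4 closes the conditional rung `BalabanLadder.UV`
only; NOT continuum ∕ ℝ⁴ ∕ infinite volume ∕ OS; the Yang–Mills mass gap (Clay) is NOT proved by any of this.
-/

noncomputable section

namespace Summit.QuantumFields.YangMills.BalabanUVNodes.N09SupportClauseAtRecord

open MeasureTheory Set Function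
open scoped ENNReal NNReal
open Literature.MathematicalPhysics.QuantumFieldTheory.Balaban1983to89
open Literature.MathematicalPhysics.QuantumFieldTheory.Balaban1983to89.T4Continuum (T4Family)
open Literature.MathematicalPhysics.QuantumFieldTheory.Balaban1983to89.Node00
open Literature.MathematicalPhysics.QuantumFieldTheory.Balaban1983to89.ExpMeanLog (deltaSU)
open Literature.MathematicalPhysics.QuantumFieldTheory.Balaban1983to89.BlockAveraging (Idx loopHol)
open Literature.MathematicalPhysics.QuantumFieldTheory.Balaban1983to89.BlockAveragingHaarAC (centralBond pre post)
open Literature.MathematicalPhysics.QuantumFieldTheory.Balaban1983to89.BlockAveragingEMLHaarAC (fibreFamily loopHol_update_centralBond_self)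
open Literature.MathematicalPhysics.QuantumFieldTheory.Balaban1983to89.LatticeWordStokes (dist1_loopHol_le)
open N09HregOfFibredChartAtRecord (mem_setOf_chi_ne_zero_of_betaInputOfRecord_ne_zero)
open N09B0RiderAtRecord (hχdom_of_hsolν_of_numerics)
open N09LiftInvariance29AtRecord (succ_le_range_of_lt)
open N09HregOfPerBondChartsAtRecord
  (measurable_triChart_record measurable_triJacobian_record avOfRecord_triChart_eq_of_jacobian_ne_zero fieldMeasure_restrict_eq_map_of_perBondCharts)

/-! ## §1  Small loops ⇒ every private coordinate sits in its central `α`-window (any gauge group) -/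

section Generic

variable {P : Params} {j : ℕ} {G : Type*} [GaugeGroup G]

/-- ★ **SMALL LOOPS AT `c` ⇒ THE PRIVATE COORDINATE `U(β c)` LIES IN ITS CENTRAL `α`-WINDOW.**  The W-coordinate family of `U` at `c` evaluated at
`W = pre·U(β c)·post` IS the loop family `loopHol U c` (pub-balaban's `loopHol_update_centralBond_self` at `g := U(β c)`, `update_eq_self`), so
`(∀ i, dist1 (loopHol U c i) ≤ α) ⇒ U(β c) ∈ {g | ∀ i, dist1 (fibreFamily U c (pre U c · g · post U c) i) ≤ α}`.
[cite: Balaban1987RG1, (0.4) p.253 and (2.9)–(2.10) pp.266–267 (bookkeeping)] -/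
theorem self_mem_centralWindow_of_loopHol_le (hj : j + 1 ≤ P.m + P.K) (U : GaugeField P j G) (c : PBond P (j + 1)) {α : ℝ}
    (h : ∀ i : Idx P, dist1 (loopHol U c i) ≤ α) :
    U (centralBond c) ∈ {g : G | ∀ i : Idx P, dist1 (fibreFamily U c (pre U c * g * post U c) i) ≤ α} := by
  classical
  have hw := loopHol_update_centralBond_self hj U c (U (centralBond c))
  rw [Function.update_eq_self] at hw
  simp only [mem_setOf_eq, ← hw]
  exact h

/-- ★ **SMALL PLAQUETTES ⇒ EVERY PRIVATE COORDINATE LIES IN ITS CENTRAL `α`-WINDOW**: `PlaqSmall δ U` with `0 ≤ δ` and `(((d+2)L)²∕4)·δ ≤ α` puts `U(β c)` in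
`Ωα c U` at every coarse bond `c` — the tree's crude non-abelian Stokes bound for the closed (0.4) words (`LatticeWordStokes.dist1_loopHol_le`) and §1's first lemma.
[cite: Balaban1985Averaging, (19)–(20) p.21; Balaban1987RG1, (0.4) p.253 and (0.18) p.255] -/
theorem self_mem_centralWindow_of_plaqSmall (hj : j + 1 ≤ P.m + P.K) {δ α : ℝ} (hδ : 0 ≤ δ) (U : GaugeField P j G) (hU : PlaqSmall δ U)
    (hα : ((((P.d + 2) * P.L : ℕ) : ℝ) ^ 2 / 4) * δ ≤ α) (c : PBond P (j + 1)) :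
    U (centralBond c) ∈ {g : G | ∀ i : Idx P, dist1 (fibreFamily U c (pre U c * g * post U c) i) ≤ α} :=
  self_mem_centralWindow_of_loopHol_le hj U c fun i => (dist1_loopHol_le hδ hU c i).trans hα

end Generic

/-! ## §2  At the Stage-13 record: the β-input is supported in the step-`j` small-field domain over the coarse domain; the support clause there -/

variable {F : T4Family} {N : ℕ} [NeZero N]

/-- ★★ **THE β-INPUT OF RECORD IS SUPPORTED IN THE STEP-`j` SMALL-FIELD DOMAIN OVER THE COARSE DOMAIN.**  For `j < K` and a step-`j` field `U` whose average is a
small coarse field (`Ū ∈ domAltOfRecord θ₀.ν K (j+1)`): `ρ_j(U) ≠ 0 ⇒ U ∈ domAltOfRecord θ₀.ν K j` — the non-vanishing β-input forces `χ^{(2.9)}_j(U) ≠ 0`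
(`mem_setOf_chi_ne_zero_of_betaInputOfRecord_ne_zero`), and dag-n09-w4 g3's `hχdom_of_hsolν_of_numerics` (the p. 266–267 rider + [B7] Prop 2 + the threshold ordering,
from [B11]-existence `hsolν` on the domain and numerics) says `U ∉ domAlt_j ⇒ χ^{(2.9)}_j(U) = 0`.  CONDITIONAL on the displayed `hsolν` and numerics; nothing of
Bałaban's asserted. [cite: Balaban1987RG1, (2.9) p.266, p.267 and (0.19) p.255; Balaban1988Convergent, p.265; Balaban1985Averaging, Prop. 2 (53) p.26] -/
theorem mem_domAltOfRecord_of_betaInput_ne_zero_of_hsolν_of_numerics (θ₀ : Stage13Params F N) (K : ℕ) (g : ℕ → ℝ) (hεreg : 0 < θ₀.ν.εreg)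
    (hε3 : (143 * (((((F.P K).d + 4 : ℕ) : ℝ)) ^ 2 / 4) ^ 2) * θ₀.ν.εreg ≤ 1 / 3)
    (hε2 : 2 * θ₀.ν.εreg ≤ 2 * deltaSU (Fin N) / ((((F.P K).d + 4) * (F.P K).L : ℕ) : ℝ) ^ 2) (hε29 : 0 ≤ θ₀.ε₂₉)
    (hn1 : 1640 * (2 * (((((F.P K).d + 2) * (F.P K).L : ℕ) : ℝ) * θ₀.ε₂₉) +
        ((((F.P K).d + 2) * (F.P K).L : ℕ) : ℝ) ^ 2 / 4 * (2 * θ₀.ν.εreg / ((F.P K).L : ℝ) ^ 2)) * (((F.P K).L : ℝ) ^ ((F.P K).d - 1)) ^ 2 ≤ 1)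
    (hn2 : 13 * (2 * (((((F.P K).d + 2) * (F.P K).L : ℕ) : ℝ) * θ₀.ε₂₉) +
        ((((F.P K).d + 2) * (F.P K).L : ℕ) : ℝ) ^ 2 / 4 * (2 * θ₀.ν.εreg / ((F.P K).L : ℝ) ^ 2)) * ((F.P K).L : ℝ) ^ ((F.P K).d - 1) < deltaSU (Fin N))
    (hord : 2 * θ₀.ν.εreg / ((F.P K).L : ℝ) ^ 2 +
      4 * max θ₀.ε₂₉ (10 * (((((F.P K).d + 2) * (F.P K).L : ℕ) : ℝ) * θ₀.ε₂₉) * ((F.P K).L : ℝ) ^ ((F.P K).d - 1)) ≤ θ₀.ν.ε₀)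
    (hsolν : ∀ j < K, ∀ W ∈ domAltOfRecord F N θ₀.ν K (j + 1), UkExists F N K (j + 1) θ₀.ν.εreg W) :
    ∀ j < K, ∀ U : GaugeField (F.P K) j (SU N), (avOfRecord F N K j).avg U ∈ domAltOfRecord F N θ₀.ν K (j + 1) →
      betaInputOfRecord F N (TβOfRecord₁₃ F N) (chiβOfRecord₁₃ F N θ₀) K g j U ≠ 0 → U ∈ domAltOfRecord F N θ₀.ν K j := by
  intro j hj U havg hρ
  by_contra hU
  exact (mem_setOf_chi_ne_zero_of_betaInputOfRecord_ne_zero (TβOfRecord₁₃ F N) (chiβOfRecord₁₃ F N θ₀) K g j U hρ)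
    (hχdom_of_hsolν_of_numerics θ₀ K g hεreg hε3 hε2 hε29 hn1 hn2 hord hsolν j hj U havg hU)

/-- The threshold ordering `hord` of the rider theorem makes `ε₀` non-negative (its left side is `≥ 0` for `0 < εreg`, `0 ≤ ε₂₉`).
[cite: Balaban1987RG1, Thm 3 p.264 (bookkeeping)] -/
theorem ε₀_nonneg_of_hord (θ₀ : Stage13Params F N) (K : ℕ) (hεreg : 0 < θ₀.ν.εreg) (hε29 : 0 ≤ θ₀.ε₂₉)
    (hord : 2 * θ₀.ν.εreg / ((F.P K).L : ℝ) ^ 2 +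
      4 * max θ₀.ε₂₉ (10 * (((((F.P K).d + 2) * (F.P K).L : ℕ) : ℝ) * θ₀.ε₂₉) * ((F.P K).L : ℝ) ^ ((F.P K).d - 1)) ≤ θ₀.ν.ε₀) :
    0 ≤ θ₀.ν.ε₀ := by
  have h1 : 0 ≤ 2 * θ₀.ν.εreg / ((F.P K).L : ℝ) ^ 2 := by positivity
  have h2 : 0 ≤ 4 * max θ₀.ε₂₉ (10 * (((((F.P K).d + 2) * (F.P K).L : ℕ) : ℝ) * θ₀.ε₂₉) * ((F.P K).L : ℝ) ^ ((F.P K).d - 1)) :=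
    mul_nonneg (by norm_num) (hε29.trans (le_max_left _ _))
  linarith

/-- ★★★ **THE SUPPORT CLAUSE OF THE PRIVATE-COORDINATE ROAD, ON THE COARSE SMALL-FIELD DOMAIN.**  For `j < K`, a step-`j` field `U` with `Ū ∈ domAlt_{j+1}` and
`ρ_j(U) ≠ 0`, and a radius `α` with `(((d+2)L)²∕4)·θ₀.ν.ε₀ ≤ α`: EVERY private coordinate `U(β c)` lies in its central `α`-window
`{g | ∀ i, dist1 (fibreFamily U c (pre U c · g · post U c) i) ≤ α}` — §2's support lemma, `mem_domAltOfRecord_iff` and §1.  This is the `hS` slot of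
dag-n09-w6 g3's `hreg_of_perBondCharts` at the central windows, RESTRICTED to the coarse domain (see §3 for why the restriction is free).  CONDITIONAL on
`hsolν` + numerics; nothing of Bałaban's asserted; `hreg` NOT discharged. [cite: Balaban1987RG1, p.259, (0.4) p.253, (2.9)–(2.10) pp.266–267; Balaban1985Averaging, (19)–(20) p.21 and Prop. 2 (53) p.26] -/
theorem supportClauseOn_of_hsolν_of_numerics (θ₀ : Stage13Params F N) (K : ℕ) (g : ℕ → ℝ) (hεreg : 0 < θ₀.ν.εreg)
    (hε3 : (143 * (((((F.P K).d + 4 : ℕ) : ℝ)) ^ 2 / 4) ^ 2) * θ₀.ν.εreg ≤ 1 / 3)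
    (hε2 : 2 * θ₀.ν.εreg ≤ 2 * deltaSU (Fin N) / ((((F.P K).d + 4) * (F.P K).L : ℕ) : ℝ) ^ 2) (hε29 : 0 ≤ θ₀.ε₂₉)
    (hn1 : 1640 * (2 * (((((F.P K).d + 2) * (F.P K).L : ℕ) : ℝ) * θ₀.ε₂₉) +
        ((((F.P K).d + 2) * (F.P K).L : ℕ) : ℝ) ^ 2 / 4 * (2 * θ₀.ν.εreg / ((F.P K).L : ℝ) ^ 2)) * (((F.P K).L : ℝ) ^ ((F.P K).d - 1)) ^ 2 ≤ 1)
    (hn2 : 13 * (2 * (((((F.P K).d + 2) * (F.P K).L : ℕ) : ℝ) * θ₀.ε₂₉) +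
        ((((F.P K).d + 2) * (F.P K).L : ℕ) : ℝ) ^ 2 / 4 * (2 * θ₀.ν.εreg / ((F.P K).L : ℝ) ^ 2)) * ((F.P K).L : ℝ) ^ ((F.P K).d - 1) < deltaSU (Fin N))
    (hord : 2 * θ₀.ν.εreg / ((F.P K).L : ℝ) ^ 2 +
      4 * max θ₀.ε₂₉ (10 * (((((F.P K).d + 2) * (F.P K).L : ℕ) : ℝ) * θ₀.ε₂₉) * ((F.P K).L : ℝ) ^ ((F.P K).d - 1)) ≤ θ₀.ν.ε₀)
    (hsolν : ∀ j < K, ∀ W ∈ domAltOfRecord F N θ₀.ν K (j + 1), UkExists F N K (j + 1) θ₀.ν.εreg W)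
    {α : ℝ} (hα : ((((F.P K).d + 2) * (F.P K).L : ℕ) : ℝ) ^ 2 / 4 * θ₀.ν.ε₀ ≤ α) :
    ∀ j < K, ∀ U : GaugeField (F.P K) j (SU N), (avOfRecord F N K j).avg U ∈ domAltOfRecord F N θ₀.ν K (j + 1) →
      betaInputOfRecord F N (TβOfRecord₁₃ F N) (chiβOfRecord₁₃ F N θ₀) K g j U ≠ 0 →
        ∀ c : PBond (F.P K) (j + 1),
          U (centralBond c) ∈ {g' : SU N | ∀ i : Idx (F.P K), dist1 (fibreFamily U c (pre U c * g' * post U c) i) ≤ α} := by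
  intro j hj U havg hρ c
  have hmem := mem_domAltOfRecord_of_betaInput_ne_zero_of_hsolν_of_numerics θ₀ K g hεreg hε3 hε2 hε29 hn1 hn2 hord hsolν j hj U havg hρ
  exact self_mem_centralWindow_of_plaqSmall (succ_le_range_of_lt hj) (ε₀_nonneg_of_hord θ₀ K hεreg hε29 hord) U
    ((mem_domAltOfRecord_iff F N θ₀.ν K j U).1 hmem) hα c

/-- **The same at a run `P`** (`K := P.K`, `g := gOfRecord₁₃ θ₀ P`) — the binder shape of dag-n09-w6 g3's `hreg_of_perBondCharts` at the central `α`-windows, localised to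
the coarse domain: `∀ j < P.K, ∀ U, Ū ∈ domAlt_{j+1} → ρ_j U ≠ 0 → ∀ c, U (centralBond c) ∈ Ωα c U`.  CONDITIONAL on `hsolν` + numerics.
[cite: Balaban1987RG1, p.259, (0.4) p.253 and (2.9)–(2.10) pp.266–267] -/
theorem supportClauseOn_runParams_of_hsolν_of_numerics (θ₀ : Stage13Params F N) (P : B12.RunParams) (hεreg : 0 < θ₀.ν.εreg)
    (hε3 : (143 * (((((F.P P.K).d + 4 : ℕ) : ℝ)) ^ 2 / 4) ^ 2) * θ₀.ν.εreg ≤ 1 / 3)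
    (hε2 : 2 * θ₀.ν.εreg ≤ 2 * deltaSU (Fin N) / ((((F.P P.K).d + 4) * (F.P P.K).L : ℕ) : ℝ) ^ 2) (hε29 : 0 ≤ θ₀.ε₂₉)
    (hn1 : 1640 * (2 * (((((F.P P.K).d + 2) * (F.P P.K).L : ℕ) : ℝ) * θ₀.ε₂₉) +
        ((((F.P P.K).d + 2) * (F.P P.K).L : ℕ) : ℝ) ^ 2 / 4 * (2 * θ₀.ν.εreg / ((F.P P.K).L : ℝ) ^ 2)) * (((F.P P.K).L : ℝ) ^ ((F.P P.K).d - 1)) ^ 2 ≤ 1)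
    (hn2 : 13 * (2 * (((((F.P P.K).d + 2) * (F.P P.K).L : ℕ) : ℝ) * θ₀.ε₂₉) +
        ((((F.P P.K).d + 2) * (F.P P.K).L : ℕ) : ℝ) ^ 2 / 4 * (2 * θ₀.ν.εreg / ((F.P P.K).L : ℝ) ^ 2)) * ((F.P P.K).L : ℝ) ^ ((F.P P.K).d - 1) <
          deltaSU (Fin N))
    (hord : 2 * θ₀.ν.εreg / ((F.P P.K).L : ℝ) ^ 2 +
      4 * max θ₀.ε₂₉ (10 * (((((F.P P.K).d + 2) * (F.P P.K).L : ℕ) : ℝ) * θ₀.ε₂₉) * ((F.P P.K).L : ℝ) ^ ((F.P P.K).d - 1)) ≤ θ₀.ν.ε₀)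
    (hsolν : ∀ j < P.K, ∀ W ∈ domAltOfRecord F N θ₀.ν P.K (j + 1), UkExists F N P.K (j + 1) θ₀.ν.εreg W)
    {α : ℝ} (hα : ((((F.P P.K).d + 2) * (F.P P.K).L : ℕ) : ℝ) ^ 2 / 4 * θ₀.ν.ε₀ ≤ α) :
    ∀ j < P.K, ∀ U : GaugeField (F.P P.K) j (SU N), (avOfRecord F N P.K j).avg U ∈ domAltOfRecord F N θ₀.ν P.K (j + 1) →
      betaInputOfRecord F N (TβOfRecord₁₃ F N) (chiβOfRecord₁₃ F N θ₀) P.K (gOfRecord₁₃ F N θ₀ P) j U ≠ 0 →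
        ∀ c : PBond (F.P P.K) (j + 1),
          U (centralBond c) ∈ {g' : SU N | ∀ i : Idx (F.P P.K), dist1 (fibreFamily U c (pre U c * g' * post U c) i) ≤ α} :=
  supportClauseOn_of_hsolν_of_numerics θ₀ P.K (gOfRecord₁₃ F N θ₀ P) hεreg hε3 hε2 hε29 hn1 hn2 hord hsolν hα

/-- ★ **THE GLOBAL-SHAPE SUPPORT CLAUSE FROM A DISPLAYED GLOBAL SUPPORT HYPOTHESIS** (any transport `T`, any χ family, any numerics `ν`): if every `ρ_j` is supported in
`domAlt_j` (`hdom`, DISPLAYED — the tree supplies it on the coarse domain only, §2) and `(((d+2)L)²∕4)·ν.ε₀ ≤ α`, `0 ≤ ν.ε₀`, then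
`∀ j < K, ∀ U, ρ_j U ≠ 0 → ∀ c, U (centralBond c) ∈ Ωα c U` — dag-n09-w6 g3's binder `hS` verbatim at the central `α`-windows.
[cite: Balaban1987RG1, p.259, (0.4) p.253 and (0.18) p.255; Balaban1985Averaging, (19)–(20) p.21] -/
theorem supportClause_of_hdom (ν : Stage7Numerics) (T : Transport F N) (χ : (K : ℕ) → (ℕ → ℝ) → (k : ℕ) → Density (F.P K) k (SU N)) (K : ℕ) (g : ℕ → ℝ)
    (hdom : ∀ j < K, ∀ U : GaugeField (F.P K) j (SU N), betaInputOfRecord F N T χ K g j U ≠ 0 → U ∈ domAltOfRecord F N ν K j)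
    (hε0 : 0 ≤ ν.ε₀) {α : ℝ} (hα : ((((F.P K).d + 2) * (F.P K).L : ℕ) : ℝ) ^ 2 / 4 * ν.ε₀ ≤ α) :
    ∀ j < K, ∀ U : GaugeField (F.P K) j (SU N), betaInputOfRecord F N T χ K g j U ≠ 0 →
      ∀ c : PBond (F.P K) (j + 1),
        U (centralBond c) ∈ {g' : SU N | ∀ i : Idx (F.P K), dist1 (fibreFamily U c (pre U c * g' * post U c) i) ≤ α} :=
  fun j hj U hρ c =>
    self_mem_centralWindow_of_plaqSmall (succ_le_range_of_lt hj) hε0 U ((mem_domAltOfRecord_iff F N ν K j U).1 (hdom j hj U hρ)) hα c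

/-! ## §3  The support-form fibred-chart doors with the support clause LOCALISED to the coarse set (the localisation is free) -/

section Local

variable {Z : Type*} [MeasurableSpace Z] {τ : Measure Z} [SFinite τ]

/-- The set identity behind the localisation: `Ū⁻¹U ∩ (S ∪ (Ū⁻¹U)ᶜ) = Ū⁻¹U ∩ S`. [cite: Balaban1987RG1, (2.10) p.267 (bookkeeping)] -/
theorem preimage_inter_union_compl_eq {K k : ℕ} (U : Set (PBond (F.P K) (k + 1) → SU N)) (S : Set (GaugeField (F.P K) k (SU N))) :
    (avOfRecord F N K k).avg ⁻¹' U ∩ (S ∪ ((avOfRecord F N K k).avg ⁻¹' U)ᶜ) = (avOfRecord F N K k).avg ⁻¹' U ∩ S := by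
  rw [inter_union_distrib_left, inter_compl_self, union_empty]

/-- A support clause localised to `Ū(x) ∈ U` is a global support clause for the enlarged set `S ∪ (Ū⁻¹U)ᶜ`. [cite: Balaban1987RG1, (2.10) p.267 (bookkeeping)] -/
theorem support_union_compl_of_on {K k : ℕ} {ρ : Density (F.P K) k (SU N)} {U : Set (PBond (F.P K) (k + 1) → SU N)}
    {S : Set (GaugeField (F.P K) k (SU N))} (hS : ∀ x, (avOfRecord F N K k).avg x ∈ U → ρ x ≠ 0 → x ∈ S) :
    ∀ x, ρ x ≠ 0 → x ∈ S ∪ ((avOfRecord F N K k).avg ⁻¹' U)ᶜ := by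
  intro x hx
  by_cases hm : (avOfRecord F N K k).avg x ∈ U
  · exact Or.inl (hS x hm hx)
  · exact Or.inr hm

/-- ★★ **dag-n09-w6 g3's SUPPORT-FORM DOOR WITH THE SUPPORT CLAUSE LOCALISED** (`Node00.RegSetOfFibredChartOnSupport.subset_regSetOfRecord_of_fibredChart_of_ne_zero` with
`hS : ∀ x, ρ x ≠ 0 → x ∈ S` weakened to `∀ x, Ū(x) ∈ U → ρ x ≠ 0 → x ∈ S`; same `hmap`, same `havgΦJ`, same `hgc`): a fibred chart of `avOfRecord F N K k` over the open
set `U`, covering the support of `ρ` OVER `U` only, gives `U ⊆ regSetOfRecord F N K k ρ`.  Proof: the door at `S ∪ (Ū⁻¹U)ᶜ`. [cite: Balaban1987RG1, (2.10) p.267, (0.13) p.254 and p.259] -/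
theorem subset_regSetOfRecord_of_fibredChart_of_ne_zero_on {K k : ℕ} (hk : k < K) {ρ : Density (F.P K) k (SU N)}
    (hρ : Integrable ρ (fieldMeasure (F.P K) k (SU N))) {U : Set (PBond (F.P K) (k + 1) → SU N)} (hU : IsOpen U)
    {S : Set (GaugeField (F.P K) k (SU N))} (hS : ∀ x, (avOfRecord F N K k).avg x ∈ U → ρ x ≠ 0 → x ∈ S)
    {Φ : (PBond (F.P K) (k + 1) → SU N) × Z → GaugeField (F.P K) k (SU N)} {J : (PBond (F.P K) (k + 1) → SU N) × Z → ℝ≥0}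
    (hΦ : Measurable Φ) (hJ : Measurable J) (havgΦJ : ∀ V ∈ U, ∀ z, J (V, z) ≠ 0 → (avOfRecord F N K k).avg (Φ (V, z)) = V)
    (hmap : (fieldMeasure (F.P K) k (SU N)).restrict ((avOfRecord F N K k).avg ⁻¹' U ∩ S)
      = ((((piHaar (F.P K) (k + 1) (SU N)).restrict U).prod τ).withDensity (fun p => (J p : ℝ≥0∞))).map Φ)
    (hgc : ContinuousOn (fun V => ∫ z, (J (V, z) : ℝ) * ρ (Φ (V, z)) ∂τ) U) :
    U ⊆ regSetOfRecord F N K k ρ := by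
  have hmap' : (fieldMeasure (F.P K) k (SU N)).restrict ((avOfRecord F N K k).avg ⁻¹' U ∩ (S ∪ ((avOfRecord F N K k).avg ⁻¹' U)ᶜ))
      = ((((piHaar (F.P K) (k + 1) (SU N)).restrict U).prod τ).withDensity (fun p => (J p : ℝ≥0∞))).map Φ := by
    rw [preimage_inter_union_compl_eq]; exact hmap
  exact subset_regSetOfRecord_of_fibredChart_of_ne_zero hk hρ hU (support_union_compl_of_on hS) hΦ hJ havgΦJ hmap' hgc

/-- ★ **… and `TcanOfRecord F N K k ρ` IS THE FIBRE INTEGRAL on `U`, support clause localised.** [cite: Balaban1987RG1, (2.10) p.267 and (0.19) p.255] -/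
theorem TcanOfRecord_eqOn_fibreIntegral_of_fibredChart_of_ne_zero_on {K k : ℕ} (hk : k < K) {ρ : Density (F.P K) k (SU N)}
    (hρ : Integrable ρ (fieldMeasure (F.P K) k (SU N))) {U : Set (PBond (F.P K) (k + 1) → SU N)} (hU : IsOpen U)
    {S : Set (GaugeField (F.P K) k (SU N))} (hS : ∀ x, (avOfRecord F N K k).avg x ∈ U → ρ x ≠ 0 → x ∈ S)
    {Φ : (PBond (F.P K) (k + 1) → SU N) × Z → GaugeField (F.P K) k (SU N)} {J : (PBond (F.P K) (k + 1) → SU N) × Z → ℝ≥0}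
    (hΦ : Measurable Φ) (hJ : Measurable J) (havgΦJ : ∀ V ∈ U, ∀ z, J (V, z) ≠ 0 → (avOfRecord F N K k).avg (Φ (V, z)) = V)
    (hmap : (fieldMeasure (F.P K) k (SU N)).restrict ((avOfRecord F N K k).avg ⁻¹' U ∩ S)
      = ((((piHaar (F.P K) (k + 1) (SU N)).restrict U).prod τ).withDensity (fun p => (J p : ℝ≥0∞))).map Φ)
    (hgc : ContinuousOn (fun V => ∫ z, (J (V, z) : ℝ) * ρ (Φ (V, z)) ∂τ) U) :
    EqOn (TcanOfRecord F N K k ρ) (fun V => ∫ z, (J (V, z) : ℝ) * ρ (Φ (V, z)) ∂τ) U := by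
  have hmap' : (fieldMeasure (F.P K) k (SU N)).restrict ((avOfRecord F N K k).avg ⁻¹' U ∩ (S ∪ ((avOfRecord F N K k).avg ⁻¹' U)ᶜ))
      = ((((piHaar (F.P K) (k + 1) (SU N)).restrict U).prod τ).withDensity (fun p => (J p : ℝ≥0∞))).map Φ := by
    rw [preimage_inter_union_compl_eq]; exact hmap
  exact TcanOfRecord_eqOn_fibreIntegral_of_fibredChart_of_ne_zero hk hρ hU (support_union_compl_of_on hS) hΦ hJ havgΦJ hmap' hgc

/-- ★★ **THE `hreg` BINDER SHAPE, SUPPORT FORM, SUPPORT CLAUSE LOCALISED TO THE COARSE DOMAIN** (`Node00.RegSetOfFibredChartOnSupport.domAlt_subset_regSetOfRecord_of_fibredChart_of_ne_zero`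
with `hS` weakened to `∀ x, Ū(x) ∈ domAlt_{k+1} → ρ x ≠ 0 → x ∈ S` — the shape §2 supplies at the central windows): `domAltOfRecord ν K (k+1) ⊆ regSetOfRecord F N K k ρ`.
RE-SHAPED, NOT DISCHARGED: the chart and the continuity stay displayed. [cite: Balaban1987RG1, p.259, (2.10) p.267 and (0.13) p.254] -/
theorem domAlt_subset_regSetOfRecord_of_fibredChart_of_ne_zero_on (ν : Stage7Numerics) {K k : ℕ} (hk : k < K) {ρ : Density (F.P K) k (SU N)}
    (hρ : Integrable ρ (fieldMeasure (F.P K) k (SU N)))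
    {S : Set (GaugeField (F.P K) k (SU N))} (hS : ∀ x, (avOfRecord F N K k).avg x ∈ domAltOfRecord F N ν K (k + 1) → ρ x ≠ 0 → x ∈ S)
    {Φ : (PBond (F.P K) (k + 1) → SU N) × Z → GaugeField (F.P K) k (SU N)} {J : (PBond (F.P K) (k + 1) → SU N) × Z → ℝ≥0}
    (hΦ : Measurable Φ) (hJ : Measurable J)
    (havgΦJ : ∀ V ∈ domAltOfRecord F N ν K (k + 1), ∀ z, J (V, z) ≠ 0 → (avOfRecord F N K k).avg (Φ (V, z)) = V)
    (hmap : (fieldMeasure (F.P K) k (SU N)).restrict ((avOfRecord F N K k).avg ⁻¹' domAltOfRecord F N ν K (k + 1) ∩ S)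
      = ((((piHaar (F.P K) (k + 1) (SU N)).restrict (domAltOfRecord F N ν K (k + 1))).prod τ).withDensity
          (fun p => (J p : ℝ≥0∞))).map Φ)
    (hgc : ContinuousOn (fun V => ∫ z, (J (V, z) : ℝ) * ρ (Φ (V, z)) ∂τ) (domAltOfRecord F N ν K (k + 1))) :
    domAltOfRecord F N ν K (k + 1) ⊆ regSetOfRecord F N K k ρ :=
  subset_regSetOfRecord_of_fibredChart_of_ne_zero_on hk hρ (B12ContinuousTransportInvarianceOn.isOpen_domAltOfRecord ν K (k + 1)) hS hΦ hJ
    havgΦJ hmap hgc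

end Local

/-! ## §4  dag-n09-w6 g3's private-coordinate door with the support clause localised, and — at the central `α`-windows — discharged -/

/-- ★★★ **`hreg` FROM PER-BOND INVERSIONS OF THE AVERAGING OF RECORD, SUPPORT CLAUSE LOCALISED TO THE COARSE DOMAIN** — dag-n09-w6 g3's
`…N09HregOfPerBondChartsAtRecord.hreg_of_perBondCharts` (p620434) VERBATIM except that the support binder reads
`hS : ∀ j < P.K, ∀ U, Ū ∈ domAlt_{j+1} → ρ_j U ≠ 0 → ∀ c, U (centralBond c) ∈ Ω j c U` (asked only over the coarse small-field domain, where the chart's `hmap` lives);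
proof = that file's §2 (`fieldMeasure_restrict_eq_map_of_perBondCharts`, `avOfRecord_triChart_eq_of_jacobian_ne_zero`, the two measurability lemmas) BY NAME into §3's localised door.
The inversions, the support clause and the continuity are displayed, not constructed. [cite: Balaban1987RG1, p.259, (0.4) p.253, (2.10) p.267 and (0.13) p.254] -/
theorem hreg_of_perBondCharts_on (θ : Stage13Params F N) (P : B12.RunParams) [∀ j, DecidableEq (PBond (F.P P.K) j)]
    (Ω T : ∀ j, PBond (F.P P.K) (j + 1) → GaugeField (F.P P.K) j (SU N) → Set (SU N))
    (ϑ : ∀ j, PBond (F.P P.K) (j + 1) → GaugeField (F.P P.K) j (SU N) → SU N → SU N)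
    (jd : ∀ j, PBond (F.P P.K) (j + 1) → GaugeField (F.P P.K) j (SU N) → SU N → ℝ≥0)
    (hint : ∀ j < P.K, Integrable (betaInputOfRecord F N (TβOfRecord₁₃ F N) (chiβOfRecord₁₃ F N θ) P.K (gOfRecord₁₃ F N θ P) j)
      (fieldMeasure (F.P P.K) j (SU N)))
    (hΩm : ∀ j < P.K, ∀ c, MeasurableSet {p : GaugeField (F.P P.K) j (SU N) × SU N | p.2 ∈ Ω j c p.1})
    (hTm : ∀ j < P.K, ∀ c, MeasurableSet {p : GaugeField (F.P P.K) j (SU N) × SU N | p.2 ∈ T j c p.1})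
    (hθm : ∀ j < P.K, ∀ c, Measurable fun p : GaugeField (F.P P.K) j (SU N) × SU N => ϑ j c p.1 p.2)
    (hjm : ∀ j < P.K, ∀ c, Measurable fun p : GaugeField (F.P P.K) j (SU N) × SU N => jd j c p.1 p.2)
    (hΩbl : ∀ j < P.K, ∀ c (U : GaugeField (F.P P.K) j (SU N)) (g : PBond (F.P P.K) (j + 1) → SU N),
      Ω j c (extend centralBond g U) = Ω j c U)
    (hright : ∀ j < P.K, ∀ c U, ∀ v ∈ T j c U, (avOfRecord F N P.K j).avg (update U (centralBond c) (ϑ j c U v)) c = v)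
    (hlaw : ∀ j < P.K, ∀ c U, (HaarData.haar : Measure (SU N)).restrict (Ω j c U) =
      (((HaarData.haar : Measure (SU N)).restrict (T j c U)).withDensity fun v => (jd j c U v : ℝ≥0∞)).map (ϑ j c U))
    (hS : ∀ j < P.K, ∀ U, (avOfRecord F N P.K j).avg U ∈ domAltOfRecord F N θ.ν P.K (j + 1) →
      betaInputOfRecord F N (TβOfRecord₁₃ F N) (chiβOfRecord₁₃ F N θ) P.K (gOfRecord₁₃ F N θ P) j U ≠ 0 → ∀ c, U (centralBond c) ∈ Ω j c U)
    (hgc : ∀ j < P.K, ContinuousOn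
      (fun V => ∫ U, (({p : (PBond (F.P P.K) (j + 1) → SU N) × GaugeField (F.P P.K) j (SU N) | ∀ c, p.1 c ∈ T j c p.2}.indicator
          (fun p => ∏ c, jd j c p.2 (p.1 c)) (V, U) : ℝ≥0) : ℝ) *
        betaInputOfRecord F N (TβOfRecord₁₃ F N) (chiβOfRecord₁₃ F N θ) P.K (gOfRecord₁₃ F N θ P) j
          (extend centralBond (fun c => ϑ j c U (V c)) U) ∂(fieldMeasure (F.P P.K) j (SU N)))
      (domAltOfRecord F N θ.ν P.K (j + 1))) :
    ∀ j < P.K, domAltOfRecord F N θ.ν P.K (j + 1) ⊆ regSetOfRecord F N P.K j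
      (betaInputOfRecord F N (TβOfRecord₁₃ F N) (chiβOfRecord₁₃ F N θ) P.K (gOfRecord₁₃ F N θ P) j) := by
  intro j hj
  exact domAlt_subset_regSetOfRecord_of_fibredChart_of_ne_zero_on (τ := fieldMeasure (F.P P.K) j (SU N)) θ.ν hj (hint j hj)
    (fun U havg hU => hS j hj U havg hU) (measurable_triChart_record (ϑ j) hj (hθm j hj))
    (measurable_triJacobian_record (T j) (jd j) (hTm j hj) (hjm j hj))
    (fun V _ U hJ => avOfRecord_triChart_eq_of_jacobian_ne_zero (T j) (ϑ j) (jd j) hj (hright j hj) hJ)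
    (fieldMeasure_restrict_eq_map_of_perBondCharts (Ω j) (T j) (ϑ j) (jd j) hj (hΩm j hj) (hTm j hj) (hθm j hj) (hjm j hj) (hΩbl j hj)
      (hright j hj) (hlaw j hj)
      (IsOpen.measurableSet (α := PBond (F.P P.K) (j + 1) → SU N)
        (B12ContinuousTransportInvarianceOn.isOpen_domAltOfRecord θ.ν P.K (j + 1))))
    (hgc j hj)

/-- ★★★ **`hreg` FROM PER-BOND INVERSIONS AT THE CENTRAL `α`-WINDOWS — THE SUPPORT CLAUSE DISCHARGED.**  Take dag-n09-w6 g3's windows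
`Ω j c U := {g | ∀ i, dist1 (fibreFamily U c (pre U c · g · post U c) i) ≤ α}` with `(((d+2)L)²∕4)·θ₀.ν.ε₀ ≤ α`.  Then the analytic inclusion `hreg` of the N09 doors (all
`j < P.K`) follows from: per-bond inversion data `(T ϑ jd; hTm hθm hjm hright hlaw)` at those windows, their joint measurability `hΩm` and blindness to the private coordinates
`hΩbl` (dag-n09-w6 g3's announced `…N09CentralWindowAtRecord.measurableSet_centralWindow` ∕ `centralWindow_extend`), (I19) `hint`, the continuity `hgc` of the fibre integrals,
[B11]-existence on the domains `hsolν` and NUMERICS — the support clause being §2's `supportClauseOn_runParams_of_hsolν_of_numerics`.  CONDITIONAL; nothing of Bałaban's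
asserted; `hreg` RE-SHAPED (one binder fewer), NOT discharged; N09 NOT discharged.
[cite: Balaban1987RG1, p.259, (0.4) p.253, (2.9)–(2.10) pp.266–267 and (0.13) p.254; Balaban1985Averaging, (19)–(20) p.21 and Prop. 2 (53) p.26; Balaban1985Variational, Thm 1 (8)–(10) p.279] -/
theorem hreg_of_perBondCharts_centralWindow_of_hsolν_of_numerics (θ₀ : Stage13Params F N) (P : B12.RunParams)
    [∀ j, DecidableEq (PBond (F.P P.K) j)] {α : ℝ}
    (T : ∀ j, PBond (F.P P.K) (j + 1) → GaugeField (F.P P.K) j (SU N) → Set (SU N))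
    (ϑ : ∀ j, PBond (F.P P.K) (j + 1) → GaugeField (F.P P.K) j (SU N) → SU N → SU N)
    (jd : ∀ j, PBond (F.P P.K) (j + 1) → GaugeField (F.P P.K) j (SU N) → SU N → ℝ≥0)
    (hint : ∀ j < P.K, Integrable (betaInputOfRecord F N (TβOfRecord₁₃ F N) (chiβOfRecord₁₃ F N θ₀) P.K (gOfRecord₁₃ F N θ₀ P) j)
      (fieldMeasure (F.P P.K) j (SU N)))
    (hΩm : ∀ j < P.K, ∀ c : PBond (F.P P.K) (j + 1),
      MeasurableSet {p : GaugeField (F.P P.K) j (SU N) × SU N | ∀ i : Idx (F.P P.K), dist1 (fibreFamily p.1 c (pre p.1 c * p.2 * post p.1 c) i) ≤ α})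
    (hTm : ∀ j < P.K, ∀ c, MeasurableSet {p : GaugeField (F.P P.K) j (SU N) × SU N | p.2 ∈ T j c p.1})
    (hθm : ∀ j < P.K, ∀ c, Measurable fun p : GaugeField (F.P P.K) j (SU N) × SU N => ϑ j c p.1 p.2)
    (hjm : ∀ j < P.K, ∀ c, Measurable fun p : GaugeField (F.P P.K) j (SU N) × SU N => jd j c p.1 p.2)
    (hΩbl : ∀ j < P.K, ∀ (c : PBond (F.P P.K) (j + 1)) (U : GaugeField (F.P P.K) j (SU N)) (g' : PBond (F.P P.K) (j + 1) → SU N),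
      {g : SU N | ∀ i : Idx (F.P P.K), dist1 (fibreFamily (extend centralBond g' U) c
          (pre (extend centralBond g' U) c * g * post (extend centralBond g' U) c) i) ≤ α} =
        {g : SU N | ∀ i : Idx (F.P P.K), dist1 (fibreFamily U c (pre U c * g * post U c) i) ≤ α})
    (hright : ∀ j < P.K, ∀ c U, ∀ v ∈ T j c U, (avOfRecord F N P.K j).avg (update U (centralBond c) (ϑ j c U v)) c = v)
    (hlaw : ∀ j < P.K, ∀ (c : PBond (F.P P.K) (j + 1)) (U : GaugeField (F.P P.K) j (SU N)),
      (HaarData.haar : Measure (SU N)).restrict {g : SU N | ∀ i : Idx (F.P P.K), dist1 (fibreFamily U c (pre U c * g * post U c) i) ≤ α} =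
        (((HaarData.haar : Measure (SU N)).restrict (T j c U)).withDensity fun v => (jd j c U v : ℝ≥0∞)).map (ϑ j c U))
    (hεreg : 0 < θ₀.ν.εreg)
    (hε3 : (143 * (((((F.P P.K).d + 4 : ℕ) : ℝ)) ^ 2 / 4) ^ 2) * θ₀.ν.εreg ≤ 1 / 3)
    (hε2 : 2 * θ₀.ν.εreg ≤ 2 * deltaSU (Fin N) / ((((F.P P.K).d + 4) * (F.P P.K).L : ℕ) : ℝ) ^ 2) (hε29 : 0 ≤ θ₀.ε₂₉)
    (hn1 : 1640 * (2 * (((((F.P P.K).d + 2) * (F.P P.K).L : ℕ) : ℝ) * θ₀.ε₂₉) +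
        ((((F.P P.K).d + 2) * (F.P P.K).L : ℕ) : ℝ) ^ 2 / 4 * (2 * θ₀.ν.εreg / ((F.P P.K).L : ℝ) ^ 2)) * (((F.P P.K).L : ℝ) ^ ((F.P P.K).d - 1)) ^ 2 ≤ 1)
    (hn2 : 13 * (2 * (((((F.P P.K).d + 2) * (F.P P.K).L : ℕ) : ℝ) * θ₀.ε₂₉) +
        ((((F.P P.K).d + 2) * (F.P P.K).L : ℕ) : ℝ) ^ 2 / 4 * (2 * θ₀.ν.εreg / ((F.P P.K).L : ℝ) ^ 2)) * ((F.P P.K).L : ℝ) ^ ((F.P P.K).d - 1) <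
          deltaSU (Fin N))
    (hord : 2 * θ₀.ν.εreg / ((F.P P.K).L : ℝ) ^ 2 +
      4 * max θ₀.ε₂₉ (10 * (((((F.P P.K).d + 2) * (F.P P.K).L : ℕ) : ℝ) * θ₀.ε₂₉) * ((F.P P.K).L : ℝ) ^ ((F.P P.K).d - 1)) ≤ θ₀.ν.ε₀)
    (hsolν : ∀ j < P.K, ∀ W ∈ domAltOfRecord F N θ₀.ν P.K (j + 1), UkExists F N P.K (j + 1) θ₀.ν.εreg W)
    (hα : ((((F.P P.K).d + 2) * (F.P P.K).L : ℕ) : ℝ) ^ 2 / 4 * θ₀.ν.ε₀ ≤ α)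
    (hgc : ∀ j < P.K, ContinuousOn
      (fun V => ∫ U, (({p : (PBond (F.P P.K) (j + 1) → SU N) × GaugeField (F.P P.K) j (SU N) | ∀ c, p.1 c ∈ T j c p.2}.indicator
          (fun p => ∏ c, jd j c p.2 (p.1 c)) (V, U) : ℝ≥0) : ℝ) *
        betaInputOfRecord F N (TβOfRecord₁₃ F N) (chiβOfRecord₁₃ F N θ₀) P.K (gOfRecord₁₃ F N θ₀ P) j
          (extend centralBond (fun c => ϑ j c U (V c)) U) ∂(fieldMeasure (F.P P.K) j (SU N)))
      (domAltOfRecord F N θ₀.ν P.K (j + 1))) :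
    ∀ j < P.K, domAltOfRecord F N θ₀.ν P.K (j + 1) ⊆ regSetOfRecord F N P.K j
      (betaInputOfRecord F N (TβOfRecord₁₃ F N) (chiβOfRecord₁₃ F N θ₀) P.K (gOfRecord₁₃ F N θ₀ P) j) :=
  hreg_of_perBondCharts_on θ₀ P
    (fun (j : ℕ) (c : PBond (F.P P.K) (j + 1)) (U : GaugeField (F.P P.K) j (SU N)) =>
      {g : SU N | ∀ i : Idx (F.P P.K), dist1 (fibreFamily U c (pre U c * g * post U c) i) ≤ α})
    T ϑ jd hint hΩm hTm hθm hjm hΩbl hright hlaw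
    (supportClauseOn_runParams_of_hsolν_of_numerics θ₀ P hεreg hε3 hε2 hε29 hn1 hn2 hord hsolν hα) hgc

end Summit.QuantumFields.YangMills.BalabanUVNodes.N09SupportClauseAtRecord

end
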